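import Literature.AlgebraicGeometry.Motives.HodgeLieWeightOnePlusPairTwinQuadratic
import Literature.AlgebraicGeometry.Motives.HodgeLieWeightOnePlusPairTwinSl2
import Literature.AlgebraicGeometry.Motives.HodgeLieComplexCenter
import Literature.AlgebraicGeometry.Motives.HodgeThetaSubalgebraReductive
import HarnessLib

/-!
# The `(m,m)` Weil square with `End_Hdg = K`: the raising operators of `Lie Hg ⊗ ℂ` are NOT all injective on `W⁻` when `8 ∤ dim V` — the «thin corner» / Mumford branch is empty (brick B1 of the (3|3) WEIL square; Moonen–Zarhin 1999 (2.3), proof of (3.4))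

Family `hodge`, layer `Literature/AlgebraicGeometry/Motives` (abstract polarizable `ℚ`-Hodge structures; no geometry), namespace
`Literature.AlgebraicGeometry.Motives.HodgeStructure`, grouping sub-namespace `WeilSquare`. THEOREMS ONLY (no definition, no named
fact, no `sorry`). Written for the cell `pub-hodgeav-hg6` (req-37 (A) Q2b; eng-4 g7, brick B1b of `HOME/jobs/WEIL33-eng4g7/DESIGN.md` §3;
lead g2 FINAL-2 «r = 3 glue»; eng-2 g6 memo c530b5d1546d8fc3). HONEST FRAMING: nothing here proves HC / HC_AV / HC_CM; unconditional
linear algebra of Hodge structures; no step towards a summit statement.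

SETTING (`Motives/HodgeThetaSubalgebraUnitary`): `H` effective polarized weight-1 on `V`, `φ ∈ End_Hdg(V)`, `φ² = −d` (`d > 0`),
`End_Hdg(V) = ℚ + ℚφ` (= `K` exactly), `μ² = −d`, `W = ker(φ_ℂ − μ)`, `W⁺ = W ∩ V^{1,0}`, `W⁻ = W ∩ V^{0,1}` with
`dim W⁺ = dim W⁻ = m ≥ 2`, `𝔷 = Lie Hg ∩ End_Hdg = 0` (for abelian varieties of Weil type: W2 `IsWeilType.hodgeLie_inf_endAlg_eq_bot_of_centre_le`),
and `8 ∤ dim_ℚ V` (for `(m,m) = (3,3)`: `dim V = 12`). In the corner language of the (3|3) square (`𝔏 = 𝔥_ℂ|_W + ℂ·1`, `E = (1+T)/2`)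
the branch «`r = m`: every non-zero raising element is injective on `W⁻`» is the THIN corner of `LeviCorner.exists_generator`.

MAIN THEOREM **`WeilSquare.exists_raising_not_injective`**: there is a raising operator `B ∈ 𝔥_ℂ` (`B V^{1,0} = 0`, `B V_ℂ ⊆ V^{1,0}`),
`B ≠ 0`, killing a non-zero vector of `W⁻` — i.e. the thin-corner branch is EMPTY. PROOF. Suppose every non-zero raising `B ∈ 𝔥_ℂ` is
injective on `W⁻`.
1. (`WeilSquare.raising_line_of_forall_injective`) The raising operators of `𝔥_ℂ` form a LINE `ℂB₀`: a non-zero one exists (the block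
   `P X_ℂ (1 − P)` of a rational `X ∈ 𝔥 ∖ End_Hdg`, `exists_mem_hodgeLie_not_mem_endAlg`, `projE_ne_zero_of_not_mem_endAlg`); two of them,
   `B`, `B₀`, restrict to maps `W⁻ → W⁺` with `B₀|` bijective (`dim W⁺ = dim W⁻`), and an eigenvalue `c` of `B₀|⁻¹ B|` gives a raising
   `B − cB₀ ∈ 𝔥_ℂ` with a kernel vector in `W⁻`, hence `B = cB₀`; the lowering line by conjugation (`conjOp_mem_spanC`).
2. The plus PAIR: `B₀C₀ = μ₀ ≠ 0` on `V^{1,0}`, `C₀B₀ = μ₀` on `V^{0,1}` (`plusLine_gradingEnd_of_plusPair`, `minusLine_gradingEnd_of_plusPair`,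
   `projE_mul_projF_eq_smul_of_plusLine_of_center_eq_bot`, `𝔷 = 0`).
3. `exists_twin_ideal_of_plusPair`: EITHER `𝔥_ℂ ≤ ⟨B₀, C₀, Θ⟩` — then `ℂw₀ ⊕ ℂC₀w₀` (`0 ≠ w₀ ∈ W⁺`) is a `Lie Hg`-stable subspace of `W` of
   dimension `≤ 2 < 2m`, contradicting the irreducibility of `W` (`UnitaryTheta.eq_bot_or_eq_of_stable`, G3); OR a twin `𝔰𝔩₂`-ideal
   (`exists_sl2Triple_of_twin`) — then `8 ∣ dim V` (`eight_dvd_finrank_of_twin_of_quadratic`, B1a; `φ` is `ψ`-skew by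
   `UnitaryTheta.form_apply_add_form_apply_eq_zero`), contradicting `8 ∤ dim V`.
For `dim V = 12`, `m = 3` this is the r = 3 branch of the (3|3) WEIL square: «some non-zero raising element of `(Lie Hg)_ℂ` has rank ≤ 2 on
`W`» — the entrance to the corner bricks Y2 / Y1 (DESIGN.md §3 B2/B3).

## References

* [MoonenZarhin1999LowDim] B. Moonen, Yu. Zarhin, Math. Ann. 315 (1999) = arXiv:math/9901113, §2 (2.3) (type III / Mumford position),
  §3 proof of Lemma (3.4) (held `paper:arxiv-math_9901113` p. 6: «pairwise non-isomorphic `hg_ℂ`-modules `U_j`»).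
* [Deligne1982HodgeCycles] P. Deligne, LNM 900 (1982), I §3 Prop. 3.4, 3.6, Example 3.7.
* [Jacobson1962LieAlgebras] N. Jacobson, *Lie Algebras* (1962), Ch. III §8, Ch. X §1.
* [Gordon1997] B. B. Gordon, arXiv:alg-geom/9709030, §6 (proof of Thm. 6.3.3, pp. 18–19).
-/

noncomputable section

open scoped TensorProduct

namespace Literature.AlgebraicGeometry.Motives

open Module

universe u

namespace HodgeStructure

variable {V : Type u} [AddCommGroup V] [Module ℚ V] [Module.Finite ℚ V] [HodgeTensorFacts.{u, u}] {n : ℤ}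

/-! ### §0 Conjugates of raising operators (plumbing) -/

omit [Module.Finite ℚ V] [HodgeTensorFacts.{u, u}] in
/-- The conjugate `C = B̄` of an operator `B` killing `P` with image in `P` kills `Q = P̄` and has image in `Q`; `conj ∘ C = B ∘ conj`,
`conj ∘ B = C ∘ conj`. Private plumbing (the tree's `SymplecticThetaTen.conjOp_raise`, restated to keep the import light). [folklore] -/
private theorem WeilSquare.conjOp_raise {P Q : Submodule ℂ (ℂ ⊗[ℚ] V)} (hPQ : ∀ x ∈ P, conj x ∈ Q)
    (hQP : ∀ x ∈ Q, conj x ∈ P) {B C : Module.End ℂ (ℂ ⊗[ℚ] V)} (hBP : ∀ p ∈ P, B p = 0)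
    (hBim : ∀ v, B v ∈ P) (hC : ∀ v, C v = conj (B (conj v))) :
    (∀ q ∈ Q, C q = 0) ∧ (∀ v, C v ∈ Q) ∧ (∀ v, conj (C v) = B (conj v)) ∧ (∀ v, conj (B v) = C (conj v)) := by
  refine ⟨fun q hq => ?_, fun v => ?_, fun v => ?_, fun v => ?_⟩
  · rw [hC, hBP _ (hQP q hq), map_zero]
  · rw [hC]; exact hPQ _ (hBim _)
  · rw [hC, conj_conj]
  · rw [hC, conj_conj]

/-! ### §1 Injective raising operators form a line -/

set_option maxHeartbeats 800000 in
/-- **The raising operators of `𝔥_ℂ` form a line** when every non-zero one is injective on `W⁻ = ker(φ_ℂ − μ) ∩ V^{0,1}` and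
`dim W⁺ = dim W⁻ > 0`: given a non-zero raising `B₀ ∈ 𝔥_ℂ`, every raising `B ∈ 𝔥_ℂ` is `cB₀` for an eigenvalue `c` of `B₀|⁻¹ ∘ B|`
on `W⁻` (`B − cB₀` is raising, in `𝔥_ℂ`, and kills an eigenvector). (The thin corner of `LeviCorner.exists_generator`, read on `V`.)
[cite: MoonenZarhin1999LowDim, §2 (2.3) and §3 proof of Lemma (3.4)] -/
theorem WeilSquare.raising_line_of_forall_injective (H : HodgeStructure V n) (hn : n = 1) (heff : H.IsEffective)
    {φ : Module.End ℚ V} (hφE : φ ∈ H.endAlg) {μ : ℂ} {Θ : Module.End ℂ (ℂ ⊗[ℚ] V)}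
    (hΘ : ∀ p, ∀ x ∈ H.piece p (n - p), Θ x = ((2 * p - n : ℤ) : ℂ) • x)
    (hdim : Module.finrank ℂ ↥(Module.End.eigenspace (φ.baseChange ℂ) μ ⊓ H.piece 0 1) =
      Module.finrank ℂ ↥(Module.End.eigenspace (φ.baseChange ℂ) μ ⊓ H.piece 1 0))
    (hpos : 0 < Module.finrank ℂ ↥(Module.End.eigenspace (φ.baseChange ℂ) μ ⊓ H.piece 0 1))
    (hinj : ∀ B ∈ H.hodgeLieC, (∀ p ∈ H.piece 1 0, B p = 0) → (∀ v, B v ∈ H.piece 1 0) → B ≠ 0 →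
      ∀ w ∈ Module.End.eigenspace (φ.baseChange ℂ) μ ⊓ H.piece 0 1, B w = 0 → w = 0)
    {B₀ : Module.End ℂ (ℂ ⊗[ℚ] V)} (hB₀ : B₀ ∈ H.hodgeLieC) (hB₀0 : B₀ ≠ 0) (hB₀P : ∀ p ∈ H.piece 1 0, B₀ p = 0)
    (hB₀im : ∀ v, B₀ v ∈ H.piece 1 0) :
    ∀ B ∈ H.hodgeLieC, (∀ p ∈ H.piece 1 0, B p = 0) → (∀ v, B v ∈ H.piece 1 0) → ∃ c : ℂ, B = c • B₀ := by
  classical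
  subst hn
  intro B hB hBP hBim
  set Φ := φ.baseChange ℂ with hΦ
  set Wm := Module.End.eigenspace Φ μ ⊓ H.piece 0 1 with hWm
  set Wp := Module.End.eigenspace Φ μ ⊓ H.piece 1 0 with hWp
  have hcφ : ∀ {Y}, Y ∈ H.hodgeLieC → Y * Φ = Φ * Y := fun {Y} hY => H.commute_baseChange_of_mem_hodgeLieC hY ⟨φ, hφE⟩
  have hmaps : ∀ {Y}, Y ∈ H.hodgeLieC → (∀ v, Y v ∈ H.piece 1 0) → ∀ x ∈ Wm, Y x ∈ Wp := fun {Y} hY hYim x hx =>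
    Submodule.mem_inf.2 ⟨UnitaryTheta.apply_mem_eigenspace_of_commute (hcφ hY) (Submodule.mem_inf.1 hx).1, hYim x⟩
  -- `B₀| : W⁻ ≃ W⁺`
  set g : Wm →ₗ[ℂ] Wp := B₀.restrict (hmaps hB₀ hB₀im) with hg
  have hginj : Function.Injective g := by
    rw [← LinearMap.ker_eq_bot, Submodule.eq_bot_iff]
    intro w hw
    rw [LinearMap.mem_ker] at hw
    have h0 : B₀ (w : ℂ ⊗[ℚ] V) = 0 := by
      have h := congrArg Subtype.val hw
      rwa [hg, LinearMap.restrict_apply] at h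
    exact Subtype.ext (hinj B₀ hB₀ hB₀P hB₀im hB₀0 w w.2 h0)
  have hgbij : Function.Bijective g := ⟨hginj, (LinearMap.injective_iff_surjective_of_finrank_eq_finrank hdim).1 hginj⟩
  set eg := LinearEquiv.ofBijective g hgbij with heg
  set f : Wm →ₗ[ℂ] Wp := B.restrict (hmaps hB hBim) with hf
  -- an eigenvalue of `B₀|⁻¹ B|`
  haveI : Nontrivial Wm := Module.nontrivial_of_finrank_pos hpos
  obtain ⟨c, hc⟩ := Module.End.exists_eigenvalue (eg.symm.toLinearMap ∘ₗ f)
  obtain ⟨w, hw⟩ := hc.exists_hasEigenvector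
  have hwc : f w = c • g w := by
    have h1 := Module.End.mem_eigenspace_iff.1 hw.1
    rw [LinearMap.comp_apply, LinearEquiv.coe_toLinearMap, LinearEquiv.symm_apply_eq, map_smul] at h1
    rw [h1, heg, LinearEquiv.ofBijective_apply]
  have hBw : (B - c • B₀) (w : ℂ ⊗[ℚ] V) = 0 := by
    have h := congrArg Subtype.val hwc
    rw [hf, hg] at h
    simp only [Submodule.coe_smul, LinearMap.coe_restrict_apply] at h
    rw [LinearMap.sub_apply, LinearMap.smul_apply, h, sub_self]
  refine ⟨c, ?_⟩
  by_contra hne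
  have hne' : B - c • B₀ ≠ 0 := fun h => hne (sub_eq_zero.1 h)
  have hmem : B - c • B₀ ∈ H.hodgeLieC := Submodule.sub_mem _ hB (Submodule.smul_mem _ _ hB₀)
  have hP : ∀ p ∈ H.piece 1 0, (B - c • B₀) p = 0 := fun p hp => by
    rw [LinearMap.sub_apply, LinearMap.smul_apply, hBP p hp, hB₀P p hp, smul_zero, sub_zero]
  have him : ∀ v, (B - c • B₀) v ∈ H.piece 1 0 := fun v => by
    rw [LinearMap.sub_apply, LinearMap.smul_apply]
    exact Submodule.sub_mem _ (hBim v) (Submodule.smul_mem _ _ (hB₀im v))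
  exact hw.2 (Subtype.ext (hinj _ hmem hP him hne' w w.2 hBw))

/-! ### §2 The thin-corner branch of the `(m,m)` Weil square is empty -/

set_option maxHeartbeats 1600000 in
/-- **In the `(m,m)` Weil square with `End_Hdg = K`, `𝔷 = 0`, `m ≥ 2` and `8 ∤ dim V`, some non-zero raising operator of `Lie Hg ⊗ ℂ`
kills a non-zero vector of `W⁻`.** Otherwise (§1) the raising operators form a line, `𝔷 = 0` upgrades it to a plus pair
(`projE_mul_projF_eq_smul_of_plusLine_of_center_eq_bot`), and `exists_twin_ideal_of_plusPair` leaves two cases: `𝔥_ℂ ≤ ⟨B₀, C₀, Θ⟩`,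
where `ℂw₀ ⊕ ℂC₀w₀` is a stable subspace of `W` of dimension `≤ 2 < 2m` (against `UnitaryTheta.eq_bot_or_eq_of_stable`), or a twin
`𝔰𝔩₂`-ideal, where `8 ∣ dim V` (`eight_dvd_finrank_of_twin_of_quadratic`). For `(m,m) = (3,3)`, `dim V = 12`: the r = 3 branch of
the (3|3) WEIL square is empty — Moonen–Zarhin's type-III / Mumford position does not occur on the `K`-eigenspaces of a Weil-type sixfold
with `End⁰ = K`. [cite: MoonenZarhin1999LowDim, §2 (2.3) and §3 proof of Lemma (3.4)] [cite: Deligne1982HodgeCycles, I §3 Prop. 3.6 and Example 3.7]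
[cite: Jacobson1962LieAlgebras, Ch. X §1] -/
theorem WeilSquare.exists_raising_not_injective [Nontrivial V] (H : HodgeStructure V n) (hn : n = 1)
    (heff : H.IsEffective) (ψ : H.Polarization) {φ : Module.End ℚ V} (hφE : φ ∈ H.endAlg) {d : ℚ} (hd : 0 < d)
    (hφ2 : φ * φ = -(d • 1)) (hE : ∀ a ∈ H.endAlg, ∃ x y : ℚ, a = x • 1 + y • φ) {μ : ℂ} (hμ : μ ^ 2 = -(d : ℂ))
    (hz : H.hodgeLie ⊓ Subalgebra.toSubmodule H.endAlg = ⊥) {m : ℕ} (hm : 2 ≤ m)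
    (hWp : Module.finrank ℂ ↥(Module.End.eigenspace (φ.baseChange ℂ) μ ⊓ H.piece 1 0) = m)
    (hWm : Module.finrank ℂ ↥(Module.End.eigenspace (φ.baseChange ℂ) μ ⊓ H.piece 0 1) = m)
    (h8 : ¬ 8 ∣ Module.finrank ℚ V) :
    ∃ B ∈ H.hodgeLieC, (∀ p ∈ H.piece 1 0, B p = 0) ∧ (∀ v, B v ∈ H.piece 1 0) ∧ B ≠ 0 ∧
      ∃ w ∈ Module.End.eigenspace (φ.baseChange ℂ) μ ⊓ H.piece 0 1, w ≠ 0 ∧ B w = 0 := by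
  classical
  subst hn
  by_contra hno
  push Not at hno
  have hinj : ∀ B ∈ H.hodgeLieC, (∀ p ∈ H.piece 1 0, B p = 0) → (∀ v, B v ∈ H.piece 1 0) → B ≠ 0 →
      ∀ w ∈ Module.End.eigenspace (φ.baseChange ℂ) μ ⊓ H.piece 0 1, B w = 0 → w = 0 := by
    intro B hB hBP hBim hB0 w hw hBw
    by_contra hw0
    exact hno B hB hBP hBim hB0 w hw hw0 hBw
  obtain ⟨hbr, hskew, hcomm, Θ, hΘ, hΘ𝔤⟩ := hodgeLie_standing H ψ
  have hΘM : Θ ∈ H.hodgeLieC := (hodgeLieC_eq_spanC H) ▸ hΘ𝔤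
  obtain ⟨hPmem, hQmem, hΘ10, hΘ01, -⟩ := UnitaryTheta.theta_facts H rfl heff hΘ
  set Φ := φ.baseChange ℂ with hΦ
  set Wp := Module.End.eigenspace Φ μ ⊓ H.piece 1 0 with hWpdef
  set Wm := Module.End.eigenspace Φ μ ⊓ H.piece 0 1 with hWmdef
  have hcφ : ∀ {Y}, Y ∈ H.hodgeLieC → Y * Φ = Φ * Y := fun {Y} hY => H.commute_baseChange_of_mem_hodgeLieC hY ⟨φ, hφE⟩
  -- a graded basis and the projector `P`
  obtain ⟨S, deg, e, hF, hFc⟩ := exists_basis_F_eq_span H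
  haveI : Fintype S := FiniteDimensional.fintypeBasisIndex e
  have hdeg : ∀ σ, deg σ = 0 ∨ deg σ = 1 := fun σ => by
    have h := heff.deg_mem_Icc_of_graded e hF hFc σ
    omega
  obtain ⟨hP1, hP0, hPim, hQim⟩ := gradingEnd_pieces_weightOne H rfl e hF hFc hdeg
  set P := gradingEnd e deg with hPdef
  -- `Θ ≠ 0`, a rational `X ∈ 𝔥 ∖ End_Hdg`, and the raising block `B₀ = P X_ℂ (1 − P)`
  have hWp0 : Wp ≠ ⊥ := fun h => by rw [h, finrank_bot] at hWp; omega
  obtain ⟨w₀, hw₀, hw₀0⟩ := (Submodule.ne_bot_iff Wp).1 hWp0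
  have hw₀P : w₀ ∈ H.piece 1 0 := (Submodule.mem_inf.1 hw₀).2
  have hw₀W : w₀ ∈ Module.End.eigenspace Φ μ := (Submodule.mem_inf.1 hw₀).1
  have hΘ0 : Θ ≠ 0 := fun h => hw₀0 (by rw [← hΘ10 w₀ hw₀P, h, LinearMap.zero_apply])
  obtain ⟨X, hX, hXE⟩ := exists_mem_hodgeLie_not_mem_endAlg H hz hΘM hΘ0
  set B₀ := P * X.baseChange ℂ * (1 - P) with hB₀def
  set C₀ := (1 - P) * X.baseChange ℂ * P with hC₀def
  have hB₀ : B₀ ∈ H.hodgeLieC := (projE_mem_hodgeLieC H e hF hFc hdeg (H.baseChange_mem_hodgeLieC hX)).1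
  have hB₀0 : B₀ ≠ 0 := (projE_ne_zero_of_not_mem_endAlg H rfl e hF hFc hdeg hXE).1
  have hB₀P : ∀ p ∈ H.piece 1 0, B₀ p = 0 := fun p hp => by
    rw [hB₀def, Module.End.mul_apply, Module.End.mul_apply, LinearMap.sub_apply, Module.End.one_apply, hP1 p hp, sub_self,
      map_zero, map_zero]
  have hB₀im : ∀ v, B₀ v ∈ H.piece 1 0 := fun v => by rw [hB₀def, Module.End.mul_apply]; exact hPim _
  have hC₀ : ∀ v, C₀ v = conj (B₀ (conj v)) := fun v => (conj_projE_conj_apply H rfl e hF hFc X v).symm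
  have hPQ : ∀ x ∈ H.piece 1 0, conj x ∈ H.piece 0 1 := fun x hx => conj_mem_piece H hx
  have hQP : ∀ x ∈ H.piece 0 1, conj x ∈ H.piece 1 0 := fun x hx => conj_mem_piece H hx
  obtain ⟨hC₀Q, hC₀im, hcC₀, hcB₀⟩ := WeilSquare.conjOp_raise hPQ hQP hB₀P hB₀im hC₀
  have hC₀M : C₀ ∈ H.hodgeLieC := by
    rw [hodgeLieC_eq_spanC] at hB₀ ⊢
    exact conjOp_mem_spanC hB₀ hC₀
  -- (1) the raising line and the lowering line
  have hline := WeilSquare.raising_line_of_forall_injective H rfl heff hφE hΘ (hWm.trans hWp.symm)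
    (Nat.lt_of_lt_of_le (by norm_num : 0 < 2) (hm.trans hWm.symm.le)) hinj hB₀ hB₀0 hB₀P hB₀im
  have hline' : ∀ C ∈ H.hodgeLieC, (∀ q ∈ H.piece 0 1, C q = 0) → (∀ v, C v ∈ H.piece 0 1) → ∃ c : ℂ, C = c • C₀ := by
    intro C' hC' hC'Q hC'im
    obtain ⟨B', hB'⟩ := exists_conjOp C'
    have hB'M : B' ∈ H.hodgeLieC := by
      rw [hodgeLieC_eq_spanC] at hC' ⊢
      exact conjOp_mem_spanC hC' hB'
    obtain ⟨hB'P, hB'im, hcB', -⟩ := WeilSquare.conjOp_raise (P := H.piece 0 1) (Q := H.piece 1 0) hQP hPQ hC'Q hC'im hB'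
    obtain ⟨c, hc⟩ := hline B' hB'M hB'P hB'im
    refine ⟨starRingEnd ℂ c, LinearMap.ext fun v => ?_⟩
    have h1 : C' v = conj (B' (conj v)) := by rw [hcB', conj_conj]
    rw [h1, hc, LinearMap.smul_apply, conj_smul, ← hC₀, LinearMap.smul_apply]
  -- (2) the plus pair `B₀ C₀ = α P`, `C₀ B₀ = α (1 − P)`
  obtain ⟨-, hplus⟩ := plusLine_gradingEnd_of_plusPair H rfl e hF hFc hdeg hX hXE hline
  obtain ⟨-, hminus⟩ := minusLine_gradingEnd_of_plusPair H rfl e hF hFc hdeg hX hXE hline'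
  obtain ⟨α, hα, hEFα, hFEα, -⟩ := projE_mul_projF_eq_smul_of_plusLine_of_center_eq_bot H ψ rfl e hF hFc hdeg hX hXE hplus
    hminus hz
  have hBC : ∀ p ∈ H.piece 1 0, B₀ (C₀ p) = α • p := fun p hp => by
    have h := LinearMap.congr_fun hEFα p
    rw [Module.End.mul_apply, LinearMap.smul_apply] at h
    rw [h, hP1 p hp]
  have hCB : ∀ q ∈ H.piece 0 1, C₀ (B₀ q) = α • q := fun q hq => by
    have h := LinearMap.congr_fun hFEα q
    rw [Module.End.mul_apply, LinearMap.smul_apply, LinearMap.sub_apply, Module.End.one_apply, hP0 q hq, sub_zero] at h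
    exact h
  -- (3) the dichotomy
  rcases exists_twin_ideal_of_plusPair H ψ rfl heff hΘ hB₀ hB₀0 hB₀P hB₀im hC₀ hα hBC hCB hline hline' hz with
    hle | ⟨W₃, C, hWle, hCle, -, hWC, hW3, hWst, -, hcommWC, hW𝔰⟩
  · -- `𝔥_ℂ ≤ ⟨B₀, C₀, Θ⟩`: a two-dimensional stable subspace of `W`
    set U : Submodule ℂ (ℂ ⊗[ℚ] V) := Submodule.span ℂ {w₀, C₀ w₀} with hUdef
    have hC₀w₀W : C₀ w₀ ∈ Module.End.eigenspace Φ μ := UnitaryTheta.apply_mem_eigenspace_of_commute (hcφ hC₀M) hw₀W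
    have hUW : U ≤ Module.End.eigenspace Φ μ := by
      rw [hUdef, Submodule.span_le]
      intro x hx
      rcases hx with rfl | rfl
      · exact hw₀W
      · exact hC₀w₀W
    have hC₀w₀Q : C₀ w₀ ∈ H.piece 0 1 := hC₀im w₀
    have hgen : ∀ Y : Module.End ℂ (ℂ ⊗[ℚ] V), Y ∈ Submodule.span ℂ (Set.range ![B₀, C₀, Θ]) → ∀ u ∈ U, Y u ∈ U := by
      intro Y hY u hu
      obtain ⟨c, hc⟩ := (Submodule.mem_span_range_iff_exists_fun ℂ).1 hY
      have hYeq : Y = c 0 • B₀ + c 1 • C₀ + c 2 • Θ := by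
        rw [← hc, Fin.sum_univ_three]; rfl
      have hw₀U : w₀ ∈ U := Submodule.subset_span (Set.mem_insert _ _)
      have hCw₀U : C₀ w₀ ∈ U := Submodule.subset_span (Set.mem_insert_of_mem _ rfl)
      have hYw₀ : Y w₀ ∈ U := by
        rw [hYeq, LinearMap.add_apply, LinearMap.add_apply, LinearMap.smul_apply, LinearMap.smul_apply, LinearMap.smul_apply,
          hB₀P w₀ hw₀P, smul_zero, zero_add, hΘ10 w₀ hw₀P]
        exact Submodule.add_mem _ (Submodule.smul_mem _ _ hCw₀U) (Submodule.smul_mem _ _ hw₀U)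
      have hYCw₀ : Y (C₀ w₀) ∈ U := by
        rw [hYeq, LinearMap.add_apply, LinearMap.add_apply, LinearMap.smul_apply, LinearMap.smul_apply, LinearMap.smul_apply,
          hBC w₀ hw₀P, hC₀Q _ hC₀w₀Q, smul_zero, add_zero, hΘ01 _ hC₀w₀Q, smul_neg]
        exact Submodule.add_mem _ (Submodule.smul_mem _ _ (Submodule.smul_mem _ _ hw₀U))
          (Submodule.neg_mem _ (Submodule.smul_mem _ _ hCw₀U))
      rw [hUdef] at hu
      induction hu using Submodule.span_induction with
      | mem x hx =>
        rcases hx with rfl | rfl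
        · exact hYw₀
        · exact hYCw₀
      | zero => rw [map_zero]; exact Submodule.zero_mem _
      | add x y _ _ hx hy => rw [map_add]; exact Submodule.add_mem _ hx hy
      | smul a x _ hx => rw [map_smul]; exact Submodule.smul_mem _ a hx
    have hU : ∀ X' ∈ H.hodgeLie, ∀ u ∈ U, X'.baseChange ℂ u ∈ U := fun X' hX' u hu =>
      hgen _ (hle (H.baseChange_mem_hodgeLieC hX')) u hu
    rcases UnitaryTheta.eq_bot_or_eq_of_stable H rfl heff ψ hφE hd hφ2 hE hμ H.hodgeLie hΘ hΘ𝔤 hcomm hskew hUW hU with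
      hbot | htop
    · exact hw₀0 ((Submodule.mem_bot ℂ).1 (hbot ▸ (Submodule.subset_span (Set.mem_insert _ _) : w₀ ∈ U)))
    · -- `dim U ≤ 2 < 2m ≤ dim W`
      have hU2 : Module.finrank ℂ U ≤ 2 := by
        have h := finrank_span_finset_le_card (R := ℂ) (M := ℂ ⊗[ℚ] V) ({w₀, C₀ w₀} : Finset (ℂ ⊗[ℚ] V))
        rw [Finset.coe_pair] at h
        change Module.finrank ℂ ↥(Submodule.span ℂ {w₀, C₀ w₀}) ≤ _ at h
        rw [hUdef]
        exact h.trans Finset.card_le_two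
      have hdisj : Wp ⊓ Wm = ⊥ := by
        rw [eq_bot_iff]
        intro x hx
        obtain ⟨hxp, hxm⟩ := Submodule.mem_inf.1 hx
        have h1 := hΘ10 x (Submodule.mem_inf.1 hxp).2
        rw [hΘ01 x (Submodule.mem_inf.1 hxm).2, neg_eq_iff_add_eq_zero, ← two_smul ℂ x, smul_eq_zero] at h1
        rw [Submodule.mem_bot]
        exact h1.resolve_left (two_ne_zero' ℂ)
      have hsum : Module.finrank ℂ ↥(Wp ⊔ Wm) = m + m := by
        have h := Submodule.finrank_sup_add_finrank_inf_eq Wp Wm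
        rw [hdisj, finrank_bot, add_zero, hWp, hWm] at h
        exact h
      have hle2 : Wp ⊔ Wm ≤ Module.End.eigenspace Φ μ := sup_le inf_le_left inf_le_left
      have hWge : m + m ≤ Module.finrank ℂ ↥(Module.End.eigenspace Φ μ) := hsum ▸ Submodule.finrank_mono hle2
      rw [← htop] at hWge
      omega
  · -- a twin `sl₂`-ideal: `8 ∣ dim V`
    have hΘ𝔰 : Θ ∈ Submodule.span ℂ (Set.range ![B₀, C₀, Θ]) := Submodule.subset_span ⟨2, rfl⟩
    have hC₀𝔰 : C₀ ∈ Submodule.span ℂ (Set.range ![B₀, C₀, Θ]) := Submodule.subset_span ⟨1, rfl⟩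
    have hWΘ : ∀ w ∈ W₃, w * Θ = Θ * w := fun w hw => hW𝔰 w hw Θ hΘ𝔰
    have hWC₀ : ∀ w ∈ W₃, w * C₀ = C₀ * w := fun w hw => hW𝔰 w hw C₀ hC₀𝔰
    obtain ⟨h', e', f', hh, he, hf, hHE, hHF, hEF, hspan⟩ := exists_sl2Triple_of_twin H ψ rfl heff hΘ hB₀ hB₀0 hB₀P
      hB₀im hC₀ hα hBC hCB hline hline' hz hWle hCle hWC hW3 hWst hcommWC
    have hφskew : ∀ v w, ψ.form (φ v) w + ψ.form v (φ w) = 0 :=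
      UnitaryTheta.form_apply_add_form_apply_eq_zero H ψ hφE hd hφ2 hE
    exact h8 (eight_dvd_finrank_of_twin_of_quadratic H ψ rfl heff hΘ hB₀ hB₀0 hB₀P hB₀im hC₀ hα hBC hCB hline hline' hz hWC hW3
      hcommWC hWΘ hWC₀ hh he hf hHE hHF hEF hspan hφE hφskew hd hφ2 hμ)

end HodgeStructure

end Literature.AlgebraicGeometry.Motives

end
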